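import Summits.BirchSwinnertonDyer.BirchSwinnertonDyer.Theorems.PrintCFramBottomClassIndexLawFiveLeLevelDictionaryBetaClass
import Summits.BirchSwinnertonDyer.BirchSwinnertonDyer.Theorems.PrintCFramBottomClassIndexLawFiveLeLevelDictionaryDescent
import Literature.NumberTheory.EllipticCurves.MordellWeilRankZeroProofs
import Literature.NumberTheory.EllipticCurves.LeadingTerm
import HarnessLib

/-!
# Route `PrintCFram`, crux C2 `BottomClassIndexLawFiveLe` (stmt-BirchSwinnertonDyer-20372), line
# `eisenstein-resource-bdp-line` (registry v19; LEAD g10 report §2(d)(β), §4 `classFactor_imp_levelPos_or_sha`):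
# **THE (β) CONSUMER, END-TO-END** — «CLASS FACTOR NON-UNIT ⟹ `Ш(W)[p] ≠ 0` OR LEVEL `n ≥ 1`» for the ψ-ALIGNED
# members (rank ≥ 1: for THE generator modulo torsion; rank 0: `Ш(W)[p] ≠ 0`), and an everywhere-unramified non-zero
# class of `H¹(ℚ, W[p]/Φ)` for the ψ-TRANSVERSE ones — conditional on Mazur–Wiles Thm. 2 only
# (cell `bsd-print-cfram`, width seat `bsd-line-cfram-p1-w5` g3; helper `--supports` 20372; 0 defs, 0 facts, 0 sorry)

HONEST FRAMING. Nothing about BSD is proved here, and nothing of any stub. This is LEAD g10's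
`classFactor_imp_levelPos_or_sha` (report §4 bullet 2), the converse half of the LEVEL DICTIONARY of B1
`stub_bsdp_of_classFactor`: B1's members (Eisenstein-IRREGULAR rank-one class members) are located among
«aligned generator `p`-divisible in `W(ℚ_p)`» ∪ «`Ш(W)[p] ≠ 0`» ∪ «ψ sits on the quotient line» — the last set being
the aligned statement for the `p`-isogenous partner `W/Φ` (whose sub line is `W[p]/Φ`). CONDITIONAL on the named fact
`MazurWiles1984.thm2_card_oddChiClassGroup_eq_bernoulli` (Ribet direction; the Herbrand direction used by (α) is a tree
theorem) and on `B_{1,ψ̃⁻¹} ≠ 0`. COMPOSITION OF TREE THEOREMS ONLY: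
w5 g3 `LevelDictionaryBeta.exists_equivariantHom_sub_or_quot_of_classFactor` (p674163: rational line `Φ`, `θ_S`,
`θ_Q`, Mazur–Wiles character transported to `Γ_ℚ`) → w4 g8's LINK
`LevelDictionary.exists_unramified_class_of_hom` (p674100: inflation–restriction at index prime to `p`) → w4 g8's
(β, Galois half) p669667 in w5 g3's crux currency `sha_or_generator_levelPos_of_unramified_sub_class_cmRamified`
(p673094) / rank-zero twin `sha_of_unramified_sub_class_of_finite_cmRamified` (p672261), with the class-side local
inputs of w6 g3's `…LevelDictionaryLocalInputs` (p671467: `W(ℚ_ℓ)[p] = 0` at bad `ℓ ≠ p`, no inertia-fixed vector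
on `Φ` / `W[p]/Φ` at `p`).

* §1 **`exists_unramified_class_of_odd_avatar_of_norm_bernoulli_lt_one`** — THE (β) SOURCE IN `H¹`-CURRENCY
  (generic): `A` a discrete `Γ_ℚ`-module of prime order `p` (`p` odd), continuous orbit maps, character `θ`;
  `λ` (any level) with `λ(χ_n τ) = Teich(θ τ)`, odd, `λ̃` not Teichmüller-congruent, `B_{1,λ̃⁻¹} ≠ 0`,
  `‖B_{1,λ̃⁻¹}‖_p < 1`, `(hMW)` ⟹ a continuous crossed homomorphism `w : Γ_ℚ → A` with NON-ZERO class, a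
  coboundary on every inertia group — the exact converse of w6 g3's `false_of_unramified_class_of_odd_avatar`
  (which has `‖B‖ = 1 ⟹ False`).
* §2 **`sha_or_levelPos_or_transverse_of_classFactor`** — ON THE CLASS, B1's binders VERBATIM minus `r_an = 1`,
  plus `bernoulliOnePrim ψ⁻¹ ≠ 0`, `(hMW)`, and a generator `g` of `W(ℚ)` modulo torsion in the crux's form:
  `(∃ c ∈ Ш(W), c ≠ 0 ∧ p • c = 0) ∨ (∃ Q : W(ℚ_[p]), p • Q = toPadicPoint p g)` ∨ TRANSVERSE
  (`∃` a stable line `Φ ≤ W[p]` of order `p` and `w : Γ_ℚ → W[p]/Φ` with non-zero class, a coboundary on every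
  inertia group); **`sha_or_transverse_of_classFactor_of_finite`** — the RANK-ZERO twin (`W(ℚ)` finite:
  `Ш(W)[p] ≠ 0` ∨ TRANSVERSE); **`…_of_analyticRank_eq_zero`** — the same from `r_an(W) = 0` granted GZK
  (`rank_eq_analyticRank_of_analyticRank_le_one`, the crux's own antecedent; `mordellWeilRank_eq_zero_iff_holds`).

THEOREMS ONLY; no definition, no named fact, no `sorry`. BSD is not proved by any of this; no summit statement is
proved by this seat. References: [MazurWiles1984] Thm. 2 (p. 216); [SerreGaloisCohomology1997] I.§2.6 (b), I.§5.1;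
[SilvermanAEC2009] VIII.§2, X.§4 (Thm. 4.2); [GreenbergLNM1716] §3; [Washington1997] §6.3, Thm. 6.17; the LEAD g10
report §2(d), §4 and ADDENDUM 1.
-/

set_option autoImplicit false
-- `…BirchSwinnertonDyer.BirchSwinnertonDyer.Theorems…` is the problem's mandated namespace (D-0017).
set_option linter.dupNamespace false

noncomputable section

open scoped Classical Pointwise

namespace Summit.BirchSwinnertonDyer.BirchSwinnertonDyer.Theorems.PrintCFram.LevelDictionaryBeta

open NumberField IsDedekindDomain Field WeierstrassCurve DirichletCharacter
open Literature.NumberTheory.EllipticCurves Literature.NumberTheory.GaloisRepresentations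
  Literature.NumberTheory.EllipticCurves.KrizLi2019 Literature.NumberTheory.NumberFields
  Literature.NumberTheory.EllipticCurves.GreenbergSelmer
open Literature.NumberTheory.EllipticCurves.Rank1Residual (CMRamified)
open Summit.BirchSwinnertonDyer.Rank1Residual
open Summit.BirchSwinnertonDyer.BirchSwinnertonDyer.Theorems.PrintCFram.LevelDictionaryAlpha
open Summit.BirchSwinnertonDyer.BirchSwinnertonDyer.Theorems.PrintCFram.LevelDictionary

variable {p : ℕ} [hp : Fact p.Prime]

/-! ## §1 The (β) source in `H¹`-currency (generic over `Γ_ℚ`) -/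

section Generic

variable {A : Type} [AddCommGroup A] [DistribMulAction (absoluteGaloisGroup ℚ) A] [TopologicalSpace A] [DiscreteTopology A]

/-- **THE (β) SOURCE IN `H¹`-CURRENCY (CONDITIONAL on Mazur–Wiles Thm. 2, Ribet direction)** — the converse of
w6 g3's `LevelDictionaryAlpha.false_of_unramified_class_of_odd_avatar`. `A` a discrete `Γ_ℚ`-module of prime order `p`
(`p` odd) with continuous orbit maps, acted on through `θ` (`g • a = θ(g)·a`, `θ g = 1 ↔ g` acts trivially); `λ` a
Dirichlet character (any level `n`) with `λ(χ_n τ) = Teich(θ τ)`, ODD, `λ̃` NOT Teichmüller-congruent, `B_{1,λ̃⁻¹} ≠ 0`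
and `‖B_{1,λ̃⁻¹}‖_p < 1`. THEN there is a continuous crossed homomorphism `w : Γ_ℚ → A` with NON-ZERO class which is
a coboundary on the inertia group of every prime of `\bar ℤ` — an everywhere-unramified non-zero class of `H¹(ℚ, A)`.
(w5 g3 `exists_equivariantHom_of_odd_avatar_of_norm_bernoulli_lt_one` + w4 g8's link `exists_unramified_class_of_hom`.)
[cite: MazurWiles1984, Thm. 2 (p. 216)] [cite: SerreGaloisCohomology1997, I.§2.6 (b) and I.§5.1]
[cite: Washington1997, §6.3 and Thm. 6.17] -/
theorem exists_unramified_class_of_odd_avatar_of_norm_bernoulli_lt_one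
    (hMW : MazurWiles1984.thm2_card_oddChiClassGroup_eq_bernoulli) (hp2 : p ≠ 2) (hcard : Nat.card A = p)
    (hcont : ∀ a : A, Continuous fun g : absoluteGaloisGroup ℚ ↦ g • a)
    (θ : absoluteGaloisGroup ℚ →* (ZMod p)ˣ)
    (hθ : ∀ (g : absoluteGaloisGroup ℚ) (a : A), g • a = (((θ g : ZMod p).val : ℕ) : ℤ) • a)
    (hker : ∀ g : absoluteGaloisGroup ℚ, θ g = 1 ↔ ∀ a : A, g • a = a)
    {n : ℕ} [NeZero n] (lam : DirichletCharacter ℚ_[p] n)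
    (hlam : ∀ τ : absoluteGaloisGroup ℚ, lam ((modNCyclotomicCharacter ℚ n τ : (ZMod n)ˣ) : ZMod n) =
      (((Kato2004.teichmullerChar p (θ τ) : ℤ_[p]ˣ) : ℤ_[p]) : ℚ_[p]))
    (hodd : lam.Odd)
    (hlamω : ¬ ∀ a : ℤ, ¬ ((p : ℤ) ∣ a) →
      ‖lam.primitiveCharacter (a : ZMod lam.conductor) - (a : ℚ_[p])‖ < 1)
    (hB0 : bernoulliOnePrim lam⁻¹ ≠ 0) (hB : ‖bernoulliOnePrim lam⁻¹‖ < 1) :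
    ∃ w : contOneCocycles (discreteTopRep (absoluteGaloisGroup ℚ) A),
      oneCocycleClass _ w ≠ 0 ∧
      ∀ (v : HeightOneSpectrum (𝓞 ℚ)) (𝔓 : Ideal (absIntegers (𝓞 ℚ) ℚ)), 𝔓 ∈ v.primesAbove →
        ∃ a : A, ∀ g ∈ 𝔓.inertia (absoluteGaloisGroup ℚ), w.1 g = g • a - a := by
  obtain ⟨G₀, hGc, hGadd, hGconj, hGI, hGne⟩ := exists_equivariantHom_of_odd_avatar_of_norm_bernoulli_lt_one hMW hp2
    hcard hcont θ hθ hker lam hlam hodd hlamω hB0 hB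
  obtain ⟨w, hw, -, hwI⟩ := exists_unramified_class_of_hom (K := ℚ) hcard hcont G₀ hGc hGadd hGconj hGI hGne
  exact ⟨w, hw, hwI⟩

end Generic

/-! ## §2 The (β) consumer on the class, in B1's binder currency -/

section Class

variable (W : WeierstrassCurve ℚ) [W.IsElliptic] [W.IsGloballyMinimal]

/-- **(β) END-TO-END ON THE CLASS: CLASS FACTOR NON-UNIT ⟹ `Ш(W)[p] ≠ 0` ∨ LEVEL `n ≥ 1` ∨ TRANSVERSE.**
`W/ℚ` globally minimal with CM, `p ≥ 5` CM-RAMIFIED; `(f, ψ, ω)` with `ψ` ODD, `ω` Teichmüller and the trace form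
(`‖a_ℓ(W) − (ψ(ℓ) + ψ⁻¹(ℓ)ω(ℓ))‖_p < 1` for `ℓ ∤ pN_W`); `B_{1,ψ̃⁻¹} ≠ 0` and the CLASS FACTOR NON-UNIT
`‖B_{1,ψ̃⁻¹}‖_p ≤ p⁻¹` (B1's premise); `g` a generator of `W(ℚ)` modulo torsion in the crux's form
(`∀ R, ∃ k T, IsOfFinAddOrder T ∧ R = k • g + T`). THEN, granted `(hMW)`, ONE of: (i) `Ш(W/ℚ)` has a NON-ZERO element
killed by `p`; (ii) the crux's LEVEL binder `∃ Q : W(ℚ_[p]), p • Q = toPadicPoint p g` (`n ≥ 1`); (iii) TRANSVERSE: for a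
`Γ_ℚ`-stable line `Φ ≤ W[p]` of order `p` there is an everywhere-unramified NON-ZERO class of `H¹(ℚ, W[p]/Φ)` (the odd
character `ψ` is the QUOTIENT character; (i)/(ii) then hold for the `p`-isogenous partner `W/Φ`). This is LEAD g10's
`classFactor_imp_levelPos_or_sha` in the kernel. [cite: MazurWiles1984, Thm. 2 (p. 216)] [cite: SilvermanAEC2009, Thm. X.4.2(a) and VIII.§2]
[cite: GreenbergLNM1716, §3 Thm. 1.2 and §4 Lemma 4.2] [cite: SerreGaloisCohomology1997, I.§2.6 (b)] -/
theorem sha_or_levelPos_or_transverse_of_classFactor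
    (hMW : MazurWiles1984.thm2_card_oddChiClassGroup_eq_bernoulli)
    (hCM : W.HasCM) (hram : CMRamified W p) (h5 : 5 ≤ p)
    {f : ℕ} [NeZero f] (ψ : DirichletCharacter ℚ_[p] f) (ω : DirichletCharacter ℚ_[p] p)
    (hψ : ψ.Odd) (hω : IsTeichmullerCharacter ω)
    (hss : ∀ ℓ : ℕ, ℓ.Prime → ¬ (ℓ ∣ p * W.conductorNorm ℤ) →
      ‖((W.LFunction ℓ : ℤ) : ℚ_[p]) - (ψ (ℓ : ZMod f) + ψ⁻¹ (ℓ : ZMod f) * ω (ℓ : ZMod p))‖ < 1)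
    (hB0 : bernoulliOnePrim ψ⁻¹ ≠ 0) (hB : ‖bernoulliOnePrim ψ⁻¹‖ ≤ (p : ℝ)⁻¹)
    {g : W.toAffine.Point}
    (hgen : ∀ R : W.toAffine.Point, ∃ (k : ℤ) (T : W.toAffine.Point), IsOfFinAddOrder T ∧ R = k • g + T) :
    (∃ c ∈ W.sha, c ≠ 0 ∧ p • c = 0) ∨
      (∃ Q : (W.baseChange ℚ_[p]).toAffine.Point, p • Q = W.toPadicPoint p g) ∨
      ∃ (Φ : X2.ResidualDevissageModules.StableSubgroup (absoluteGaloisGroup ℚ) (W.geomTorsion (p : ℤ)))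
        (w : contOneCocycles (discreteTopRep (absoluteGaloisGroup ℚ) Φ.Quot)),
        Nat.card Φ.Sub = p ∧ oneCocycleClass _ w ≠ 0 ∧
        ∀ (v : HeightOneSpectrum (𝓞 ℚ)) (𝔓 : Ideal (absIntegers (𝓞 ℚ) ℚ)), 𝔓 ∈ v.primesAbove →
          ∃ y : Φ.Quot, ∀ γ ∈ 𝔓.inertia (absoluteGaloisGroup ℚ), w.1 γ = γ • y - y := by
  obtain ⟨Φ, θS, θQ, hcard, hθS, hkerS, hθQ, hkerQ, hprod, hcases⟩ :=
    exists_equivariantHom_sub_or_quot_of_classFactor W hMW hCM hram h5 ψ ω hψ hω hss hB0 hB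
  have hcontS : ∀ x : Φ.Sub, Continuous fun γ : absoluteGaloisGroup ℚ ↦ γ • x :=
    Φ.continuous_smul_sub (HerbrandLineRestriction.continuous_smul_geomTorsion W (p : ℤ))
  have hcontQ : ∀ y : Φ.Quot, Continuous fun γ : absoluteGaloisGroup ℚ ↦ γ • y :=
    Φ.continuous_smul_quot (HerbrandLineRestriction.continuous_smul_geomTorsion W (p : ℤ))
  have hcardQ : Nat.card Φ.Quot = p := HerbrandLineRestriction.natCard_quot_eq_of_card_sub W Φ hcard
  rcases hcases with ⟨G₀, hGc, hGadd, hGconj, hGI, hGne⟩ | ⟨G₀, hGc, hGadd, hGconj, hGI, hGne⟩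
  · -- ALIGNED: an unramified non-zero class of the SUB line, then (β, Galois half) in the crux's currency
    obtain ⟨w, hw, -, hwI⟩ := exists_unramified_class_of_hom (K := ℚ) hcard hcontS G₀ hGc hGadd hGconj hGI hGne
    -- the class-side local inputs (w6 g3)
    have hQΓ : ∀ q : Φ.Quot, (∀ γ : absoluteGaloisGroup ℚ, γ • q = q) → q = 0 := by
      intro q hq
      obtain ⟨v, hv⟩ := exists_heightOneSpectrum_rat_natCast_mem hp.out
      exact quot_eq_zero_of_forall_inertia_smul_eq_at_p W Φ hCM h5 hram hcard hv
        (adicCompletionPrime_mem_primesAbove ℚ v) q fun γ _ ↦ hq γ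
    have hSp : ∀ v : HeightOneSpectrum (𝓞 ℚ), ((p : ℕ) : 𝓞 ℚ) ∈ v.asIdeal →
        ∀ s : Φ.Sub, (∀ γ ∈ (adicCompletionPrime ℚ v).inertia (absoluteGaloisGroup ℚ), γ • s = s) → s = 0 :=
      fun v hv s hs ↦ sub_eq_zero_of_forall_inertia_smul_eq_at_p W Φ hCM h5 hram hcard hv
        (adicCompletionPrime_mem_primesAbove ℚ v) s hs
    have hbad : ∀ v : HeightOneSpectrum (𝓞 ℚ), ¬ W.HasGoodReductionAt v → ((p : ℕ) : 𝓞 ℚ) ∉ v.asIdeal →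
        ∀ P : (W.baseChange (v.adicCompletion ℚ)).toAffine.Point, p • P = 0 → P = 0 :=
      fun v hbadv hpv ↦ forall_prime_nsmul_eq_zero_adicCompletion_of_bad (K := ℚ) W hCM hram h5 hpv hbadv
    rcases sha_or_generator_levelPos_of_unramified_sub_class_cmRamified W p hCM h5 hram hgen Φ hQΓ hSp hbad w hw hwI
      with h | h
    · exact Or.inl h
    · exact Or.inr (Or.inl h)
  · -- TRANSVERSE: an unramified non-zero class of the QUOTIENT line
    obtain ⟨w, hw, -, hwI⟩ := exists_unramified_class_of_hom (K := ℚ) hcardQ hcontQ G₀ hGc hGadd hGconj hGI hGne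
    exact Or.inr (Or.inr ⟨Φ, w, hcard, hw, hwI⟩)

/-- **(β) RANK-ZERO TWIN ON THE CLASS: CLASS FACTOR NON-UNIT ⟹ `Ш(W)[p] ≠ 0` ∨ TRANSVERSE** when `W(ℚ)` is FINITE
(the shape of the Heegner twists `W^{(d)}` of a rank-one member). Same binders as
`sha_or_levelPos_or_transverse_of_classFactor` with the generator replaced by `Finite W(ℚ)`; via w5 g3's
`sha_of_unramified_sub_class_of_finite_cmRamified` (p672261). This is the descent half of LEAD g10 ADDENDUM 1's reading of
B2′ as an `L`-VALUE statement (an Eisenstein-irregular rank-zero member has `Ш[p] ≠ 0` on the ψ-aligned model).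
[cite: MazurWiles1984, Thm. 2 (p. 216)] [cite: SilvermanAEC2009, Thm. X.4.2(a)] [cite: GreenbergLNM1716, §3 Thm. 1.2 and §4 Lemma 4.2] -/
theorem sha_or_transverse_of_classFactor_of_finite
    (hMW : MazurWiles1984.thm2_card_oddChiClassGroup_eq_bernoulli)
    (hCM : W.HasCM) (hram : CMRamified W p) (h5 : 5 ≤ p) (hfin : Finite W.toAffine.Point)
    {f : ℕ} [NeZero f] (ψ : DirichletCharacter ℚ_[p] f) (ω : DirichletCharacter ℚ_[p] p)
    (hψ : ψ.Odd) (hω : IsTeichmullerCharacter ω)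
    (hss : ∀ ℓ : ℕ, ℓ.Prime → ¬ (ℓ ∣ p * W.conductorNorm ℤ) →
      ‖((W.LFunction ℓ : ℤ) : ℚ_[p]) - (ψ (ℓ : ZMod f) + ψ⁻¹ (ℓ : ZMod f) * ω (ℓ : ZMod p))‖ < 1)
    (hB0 : bernoulliOnePrim ψ⁻¹ ≠ 0) (hB : ‖bernoulliOnePrim ψ⁻¹‖ ≤ (p : ℝ)⁻¹) :
    (∃ c ∈ W.sha, c ≠ 0 ∧ p • c = 0) ∨
      ∃ (Φ : X2.ResidualDevissageModules.StableSubgroup (absoluteGaloisGroup ℚ) (W.geomTorsion (p : ℤ)))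
        (w : contOneCocycles (discreteTopRep (absoluteGaloisGroup ℚ) Φ.Quot)),
        Nat.card Φ.Sub = p ∧ oneCocycleClass _ w ≠ 0 ∧
        ∀ (v : HeightOneSpectrum (𝓞 ℚ)) (𝔓 : Ideal (absIntegers (𝓞 ℚ) ℚ)), 𝔓 ∈ v.primesAbove →
          ∃ y : Φ.Quot, ∀ γ ∈ 𝔓.inertia (absoluteGaloisGroup ℚ), w.1 γ = γ • y - y := by
  obtain ⟨Φ, θS, θQ, hcard, hθS, hkerS, hθQ, hkerQ, hprod, hcases⟩ :=
    exists_equivariantHom_sub_or_quot_of_classFactor W hMW hCM hram h5 ψ ω hψ hω hss hB0 hB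
  have hcontS : ∀ x : Φ.Sub, Continuous fun γ : absoluteGaloisGroup ℚ ↦ γ • x :=
    Φ.continuous_smul_sub (HerbrandLineRestriction.continuous_smul_geomTorsion W (p : ℤ))
  have hcontQ : ∀ y : Φ.Quot, Continuous fun γ : absoluteGaloisGroup ℚ ↦ γ • y :=
    Φ.continuous_smul_quot (HerbrandLineRestriction.continuous_smul_geomTorsion W (p : ℤ))
  have hcardQ : Nat.card Φ.Quot = p := HerbrandLineRestriction.natCard_quot_eq_of_card_sub W Φ hcard
  rcases hcases with ⟨G₀, hGc, hGadd, hGconj, hGI, hGne⟩ | ⟨G₀, hGc, hGadd, hGconj, hGI, hGne⟩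
  · obtain ⟨w, hw, -, hwI⟩ := exists_unramified_class_of_hom (K := ℚ) hcard hcontS G₀ hGc hGadd hGconj hGI hGne
    have hQΓ : ∀ q : Φ.Quot, (∀ γ : absoluteGaloisGroup ℚ, γ • q = q) → q = 0 := by
      intro q hq
      obtain ⟨v, hv⟩ := exists_heightOneSpectrum_rat_natCast_mem hp.out
      exact quot_eq_zero_of_forall_inertia_smul_eq_at_p W Φ hCM h5 hram hcard hv
        (adicCompletionPrime_mem_primesAbove ℚ v) q fun γ _ ↦ hq γ
    have hSp : ∀ v : HeightOneSpectrum (𝓞 ℚ), ((p : ℕ) : 𝓞 ℚ) ∈ v.asIdeal →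
        ∀ s : Φ.Sub, (∀ γ ∈ (adicCompletionPrime ℚ v).inertia (absoluteGaloisGroup ℚ), γ • s = s) → s = 0 :=
      fun v hv s hs ↦ sub_eq_zero_of_forall_inertia_smul_eq_at_p W Φ hCM h5 hram hcard hv
        (adicCompletionPrime_mem_primesAbove ℚ v) s hs
    have hbad : ∀ v : HeightOneSpectrum (𝓞 ℚ), ¬ W.HasGoodReductionAt v → ((p : ℕ) : 𝓞 ℚ) ∉ v.asIdeal →
        ∀ P : (W.baseChange (v.adicCompletion ℚ)).toAffine.Point, p • P = 0 → P = 0 :=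
      fun v hbadv hpv ↦ forall_prime_nsmul_eq_zero_adicCompletion_of_bad (K := ℚ) W hCM hram h5 hpv hbadv
    exact Or.inl (sha_of_unramified_sub_class_of_finite_cmRamified W p hCM h5 hram hfin Φ hQΓ hSp hbad w hw hwI)
  · obtain ⟨w, hw, -, hwI⟩ := exists_unramified_class_of_hom (K := ℚ) hcardQ hcontQ G₀ hGc hGadd hGconj hGI hGne
    exact Or.inr ⟨Φ, w, hcard, hw, hwI⟩

/-- **(β) RANK-ZERO TWIN, from `r_an(W) = 0` granted GZK.** As `sha_or_transverse_of_classFactor_of_finite`, with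
`Finite W(ℚ)` discharged from `W.analyticRank = 0` and the Gross–Zagier–Kolyvagin named fact
`rank_eq_analyticRank_of_analyticRank_le_one` (the crux's own antecedent; rank `0`, Mordell–Weil, `mordellWeilRank_eq_zero_iff_holds`).
[cite: MazurWiles1984, Thm. 2 (p. 216)] [cite: SilvermanAEC2009, Thm. X.4.2(a) and VIII.6.7] [cite: GrossZagier1986, Thm. I.(6.3)] -/
theorem sha_or_transverse_of_classFactor_of_analyticRank_eq_zero
    (hGZK : rank_eq_analyticRank_of_analyticRank_le_one)
    (hMW : MazurWiles1984.thm2_card_oddChiClassGroup_eq_bernoulli)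
    (hCM : W.HasCM) (hram : CMRamified W p) (h5 : 5 ≤ p) (hr : W.analyticRank = 0)
    {f : ℕ} [NeZero f] (ψ : DirichletCharacter ℚ_[p] f) (ω : DirichletCharacter ℚ_[p] p)
    (hψ : ψ.Odd) (hω : IsTeichmullerCharacter ω)
    (hss : ∀ ℓ : ℕ, ℓ.Prime → ¬ (ℓ ∣ p * W.conductorNorm ℤ) →
      ‖((W.LFunction ℓ : ℤ) : ℚ_[p]) - (ψ (ℓ : ZMod f) + ψ⁻¹ (ℓ : ZMod f) * ω (ℓ : ZMod p))‖ < 1)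
    (hB0 : bernoulliOnePrim ψ⁻¹ ≠ 0) (hB : ‖bernoulliOnePrim ψ⁻¹‖ ≤ (p : ℝ)⁻¹) :
    (∃ c ∈ W.sha, c ≠ 0 ∧ p • c = 0) ∨
      ∃ (Φ : X2.ResidualDevissageModules.StableSubgroup (absoluteGaloisGroup ℚ) (W.geomTorsion (p : ℤ)))
        (w : contOneCocycles (discreteTopRep (absoluteGaloisGroup ℚ) Φ.Quot)),
        Nat.card Φ.Sub = p ∧ oneCocycleClass _ w ≠ 0 ∧
        ∀ (v : HeightOneSpectrum (𝓞 ℚ)) (𝔓 : Ideal (absIntegers (𝓞 ℚ) ℚ)), 𝔓 ∈ v.primesAbove →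
          ∃ y : Φ.Quot, ∀ γ ∈ 𝔓.inertia (absoluteGaloisGroup ℚ), w.1 γ = γ • y - y := by
  have hrank : W.mordellWeilRank = 0 := by rw [(hGZK W (by rw [hr]; exact zero_le_one)).1, hr]
  have hfin : Finite W.toAffine.Point := W.mordellWeilRank_eq_zero_iff_holds.mp hrank
  exact sha_or_transverse_of_classFactor_of_finite W hMW hCM hram h5 hfin ψ ω hψ hω hss hB0 hB

end Class

end Summit.BirchSwinnertonDyer.BirchSwinnertonDyer.Theorems.PrintCFram.LevelDictionaryBeta

end
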